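import Literature.Probability.Percolation.ArmSeparationOutSlotsFour
import Literature.Probability.Percolation.AdjLaneObjects
import HarnessLib

/-!
# Tip data of the adjacent outer landing: the four exits, their spoke rows and lane objects

Topic `Literature/Probability/Percolation`; family `crit-perc` / near-critical percolation on `𝕋`.
A brick of the near-critical arm-separation theorem for four arms in the ADJACENT colour
arrangement (P. Nolin, EJP 13 (2008), Thm. 11, `j = 4`, `σ = BBWW` [arXiv 0711.4948: Thm. 10],
landing step, §4.4 p. 12 with Prop. 12 (i)); the adjacent twin of the tip data of
`ArmSeparationOutRouteFour.lean`.

The covering lemma of the adjacent outer landing extracts from a configuration four EXITS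
(`TrapExit`, `TrapFencedExit.lean`): `a = 0, 1` of the open colour (from the pair step of the two
open arms: `PairData.exitOfRoute` on a common side, `CrossData.exitBelow₁/exitUp₁` on different
sides) and `a = 2, 3` of the closed colour. An exit has a side `i a < 6` (read through `ρ^{i a}`), a
KIND (`up a`: the fence of a term from above, whose corner box lies BELOW its tip), a true tip row
`t a`, a scale index `j a` (`k = k₀ 32^j`), hence a nominal row `ζ a` (`= t a`, or `t a - 3k` for a
fence from above) in a window `[T, T + w)` of index `ν a`, and a spoke: the rows
`[ξ, ξ + 2ε]`, `ξ = T + w + k + k/4`, of its side. This file records the numbers (`AdjTipData`), the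
predicate `AdjTipData.Good` they satisfy — ranges, middle tips, and on a common side: two exits of
the same colour are fences from below more than `17k` apart (`PairDataA.row_gap_of_lt`), and a
tip whose protection faces a tip of the other colour is more than `8k` from it (`tip_gap_above`,
`tip_gap_below`, `AdjExitGaps.lean`; in the two "glued" positions no gap holds, but the spokes point
away from each other) — and its consequences for the lanes: the spoke rows of distinct exits on a
common side are six chunks apart (`Good.gap`, chunk `sA = k₀/4`), their order is the order of the
tips (`Good.t_lt_iff`), the lane objects are in range and separated (`Good.obj_ok`, `Good.obj_sep`).

Everything here is proved; no named facts are introduced.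

## References

* P. Nolin, Near-critical percolation in two dimensions, *Electron. J. Probab.* 13 (2008), §4.2
  Def. 6–8, §4.3 Prop. 12 (i), §4.4 (arXiv 0711.4948: Def. 6–8, Prop. 11; proof of Thm. 10, p. 12) [Nolin2008].
-/

namespace Literature.Probability.Percolation

open Lanes

/-! ### The adjacent chunk -/

namespace OParams

variable (P : OParams)

/-- **The chunk of the adjacent landing**: `sA = k₀ / 4` (a quarter of the chunk `s = k₀` of the
alternating landing, so that the spokes of two glued exits — `> kₐ + k_b ≥ 2k₀` apart — are more than
six chunks apart, the room for the cut). [folklore] -/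
def sA : ℕ := P.k₀ / 4

/-- **A valid adjacent rung**: a valid rung whose smallest scale is a multiple of four. [folklore] -/
structure ValidA (P : OParams) : Prop extends P.Valid where
  /-- the smallest scale is a multiple of four -/
  hfour : 4 ∣ P.k₀

/-- chunks (of length `sA`) per side of the ring of level `ℓ` [folklore] -/
def nA (ℓ : ℕ) : ℕ := P.rL ℓ / P.sA
/-- tubes of the ring of level `ℓ`, in chunks of length `sA` [folklore] -/
def GrA (ℓ : ℕ) : ℕ := 12 * P.nA ℓ - 4
/-- pieces (of length `sA`) in an exit run: `(dA - 1) sA ≥ N'/64` [folklore] -/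
def dA : ℕ := P.N' / 64 / P.sA + 3
/-- number of windows of nominal tip rows [folklore] -/
def NwA : ℕ := P.nA 0 + 1
/-- **start of the `ν`-th window**, on the grid of the ring roads: `-rL 0 + ν sA` (all ring radii are
multiples of `sA`, so a spoke starting at a window row plus multiples of `sA` starts at a piece boundary
of every ring). [folklore] -/
def TA (ν : ℕ) : ℤ := -(P.rL 0 : ℤ) + ν * P.sA

variable {P}

/-- Numeric facts of the adjacent chunk: `4 sA = k₀`, `16 ≤ sA`. [folklore] -/
theorem ValidA.sA_facts (hV : P.ValidA) : 4 * P.sA = P.k₀ ∧ 16 ≤ P.sA := by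
  have h := hV.hk₀
  obtain ⟨q, hq⟩ := hV.hfour
  unfold sA
  omega

/-- **The ring of level `ℓ < 8` in adjacent chunks**: `nA sA = rL`, `1 ≤ nA`, `2M ≤ rL`, `1 ≤ sA`. [folklore] -/
theorem ValidA.ringA_facts (hV : P.ValidA) {ℓ : ℕ} (hℓ : ℓ < 8) :
    P.nA ℓ * P.sA = P.rL ℓ ∧ 1 ≤ P.nA ℓ ∧ 2 * P.M ≤ P.rL ℓ ∧ 1 ≤ P.sA ∧ ((P.nA ℓ : ℕ) : ℤ) * P.sA = P.rL ℓ := by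
  obtain ⟨h1, -, -, -, -, -, -, -⟩ := hV.toValid.ring_facts hℓ
  obtain ⟨hsA, hsA16⟩ := hV.sA_facts
  have hs : P.s = P.k₀ := rfl
  have hdiv : P.sA ∣ P.rL ℓ := by
    refine ⟨4 * ((2 * P.M + (2 * ℓ + 1) * P.μ) / P.s + 1), ?_⟩
    unfold OParams.rL; rw [hs, ← hsA]; ring
  have hmul : P.nA ℓ * P.sA = P.rL ℓ := by unfold nA; exact Nat.div_mul_cancel hdiv
  have hn1 : 1 ≤ P.nA ℓ := by
    refine Nat.pos_of_ne_zero fun h0 => ?_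
    rw [h0, zero_mul] at hmul; omega
  exact ⟨hmul, hn1, by omega, by omega, by exact_mod_cast hmul⟩

/-- The exit run in adjacent chunks covers the approach rows: `N'/64 ≤ (dA - 1) sA ≤ N'/64 + 2 sA`. [folklore] -/
theorem ValidA.dA_facts (hV : P.ValidA) :
    ((P.N' / 64 : ℕ) : ℤ) ≤ ((P.dA - 1 : ℕ) : ℤ) * P.sA ∧ ((P.dA - 1 : ℕ) : ℤ) * P.sA ≤ (P.N' / 64 : ℕ) + 2 * P.sA := by
  obtain ⟨-, hsA16⟩ := hV.sA_facts
  have hk : 1 ≤ P.sA := by omega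
  have hd : P.dA - 1 = P.N' / 64 / P.sA + 2 := by unfold OParams.dA; generalize P.N' / 64 / P.sA = x; omega
  constructor
  · rw [hd]; have := Nat.lt_div_mul_add (a := P.N' / 64) hk; push_cast at this ⊢; nlinarith
  · rw [hd]; have := Nat.div_mul_le_self (P.N' / 64) P.sA; push_cast at this ⊢; nlinarith

/-- **The windows cover the tip rows**: `TA 0 ≤ -2M` and `0 ≤ TA (nA 0)`; the window starts are
`≡ 0` modulo `sA` relative to every ring radius. [folklore] -/
theorem ValidA.TA_facts (hV : P.ValidA) : P.TA 0 ≤ -(2 * (P.M : ℤ)) ∧ 0 ≤ P.TA (P.nA 0) ∧ ∀ ν, P.TA (ν + 1) = P.TA ν + P.sA := by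
  obtain ⟨-, -, h3, -, h5⟩ := hV.ringA_facts (show 0 < 8 by norm_num)
  unfold TA
  refine ⟨by push_cast; omega, by rw [← h5]; ring_nf; exact le_rfl, fun ν => by push_cast; ring⟩

end OParams

/-! ### The tip data -/

/-- **The tip data of the four exits** (`a = 0, 1` open, `a = 2, 3` closed): sides, scale indices,
kinds, true tip rows, window indices of the nominal rows. [folklore] -/
structure AdjTipData where
  /-- sides -/
  i : Fin 4 → ℕ
  /-- scale indices -/
  j : Fin 4 → ℕ
  /-- kinds: `true` for the fence of a term from above -/
  up : Fin 4 → Bool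
  /-- true tip rows -/
  t : Fin 4 → ℤ
  /-- window indices of the nominal rows -/
  ν : Fin 4 → ℕ

namespace AdjTipData

variable (P : OParams) (D : AdjTipData)

/-- scale of the exit `a` [folklore] -/
def k (a : Fin 4) : ℕ := trapScale P.k₀ (D.j a)
/-- nominal row of the exit `a`: the true tip row, lowered by `3k` for a fence from above [folklore] -/
def ζ (a : Fin 4) : ℤ := if D.up a then D.t a - 3 * D.k P a else D.t a
/-- window start of the exit `a` (on the grid of the ring roads) [folklore] -/
def T (a : Fin 4) : ℤ := P.TA (D.ν a)
/-- bottom row of the spoke of the exit `a` (`extSpokeTube`: `T + w + k + k/4`) [folklore] -/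
def ξ (a : Fin 4) : ℤ := D.T P a + P.w + D.k P a + (D.k P a / 4 : ℕ)
/-- colour of the exit `a`: open for `a = 0, 1` [folklore] -/
def col (a : Fin 4) : Bool := decide ((a : ℕ) < 2)
/-- **the lane object of the exit `a`**: its side and the rows `[ξ, ξ + 2ε]` of its spoke [folklore] -/
def obj (a : Fin 4) : RingObj := ⟨D.i a, D.ξ P a, D.ξ P a + 2 * P.ε⟩
/-- spoke key of the exit `a` [folklore] -/
def κ (a : Fin 4) : ℤ := rotKey P.M (D.i a) (D.ξ P a)
/-- tip key of the exit `a` [folklore] -/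
def κt (a : Fin 4) : ℤ := rotKey P.M (D.i a) (D.t a)

/-- **Good tip data** (what the covering lemma provides): ranges, the nominal row in its window,
middle tips (margin `R₀` from the corners), and on a common side: distinct tip rows, two exits of the
same colour are fences from below with tips `17k` apart, and a tip facing a tip of the other colour
(a fence from below facing up, a fence from above facing down) is `8k` away from it. [folklore] -/
structure Good : Prop where
  /-- sides -/
  hi : ∀ a, D.i a < 6
  /-- scale indices -/
  hj : ∀ a, D.j a < P.K
  /-- windows -/
  hν : ∀ a, D.ν a < P.NwA
  /-- the nominal row lies in its window -/
  hζ : ∀ a, D.T P a ≤ D.ζ P a ∧ D.ζ P a < D.T P a + P.w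
  /-- middle tips -/
  hmid : ∀ a, -(2 * (P.M : ℤ)) + P.R₀ ≤ D.t a ∧ D.t a ≤ -(P.R₀ : ℤ)
  /-- distinct exits on a common side have distinct tip rows -/
  htne : ∀ a b, a ≠ b → D.i a = D.i b → D.t a ≠ D.t b
  /-- same colour on a common side: fences from below, `17k` apart -/
  hsame : ∀ a b, a ≠ b → col a = col b → D.i a = D.i b →
    D.up a = false ∧ (D.t a < D.t b → D.t a + 17 * D.k P a < D.t b)
  /-- other colour on a common side: a facing tip is `8k` away -/
  hdiff : ∀ a b, col a ≠ col b → D.i a = D.i b →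
    ((D.up a = false ∧ D.t a < D.t b) ∨ (D.up a = true ∧ D.t b < D.t a)) →
      D.t a + 8 * D.k P a < D.t b ∨ D.t b + 8 * D.k P a < D.t a

variable {P D}

/-- **Numeric facts of good tip data** in a valid adjacent rung. [folklore] -/
theorem Good.facts (hV : P.ValidA) (hD : D.Good P) (a : Fin 4) :
    (P.k₀ : ℤ) ≤ D.k P a ∧ 32 * (D.k P a : ℤ) ≤ P.μ ∧ 4 * (P.sA : ℤ) = P.k₀ ∧ 4 * (P.w : ℤ) ≤ P.k₀ ∧ 16 * (P.ε : ℤ) ≤ P.k₀ ∧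
      64 ≤ (P.k₀ : ℤ) ∧ 4 * ((D.k P a / 4 : ℕ) : ℤ) ≤ D.k P a ∧ (D.k P a : ℤ) ≤ 4 * ((D.k P a / 4 : ℕ) : ℤ) + 3 ∧
      D.ξ P a = D.T P a + P.w + D.k P a + (D.k P a / 4 : ℕ) ∧
      D.T P a ≤ D.ζ P a ∧ D.ζ P a < D.T P a + P.w ∧ -(2 * (P.M : ℤ)) + P.R₀ ≤ D.t a ∧ D.t a ≤ -(P.R₀ : ℤ) ∧
      8 * (P.μ : ℤ) ≤ P.R₀ ∧ 4 * (P.R₀ : ℤ) ≤ P.M := by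
  obtain ⟨-, hk₀, -, hw1, -, -, -, hε1, -, -, -, -, -, -, -, -, -, -, -, -, hR₀, hR₀M, -, -⟩ := hV.toValid.ifacts
  have hk1 : (P.k₀ : ℤ) ≤ D.k P a := by exact_mod_cast le_trapScale P.k₀ (D.j a)
  have hk2 : 32 * (D.k P a : ℤ) ≤ P.μ := by exact_mod_cast P.scale_le (hD.hj a)
  have hsA : 4 * (P.sA : ℤ) = P.k₀ := by exact_mod_cast hV.sA_facts.1
  obtain ⟨z1, z2⟩ := hD.hζ a
  obtain ⟨g1, g2⟩ := hD.hmid a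
  exact ⟨hk1, hk2, hsA, hw1, hε1, hk₀, by omega, by omega, rfl, z1, z2, g1, g2, hR₀, hR₀M⟩

/-- The nominal row unfolded by kind. [folklore] -/
theorem ζ_eq (a : Fin 4) : (D.up a = false → D.ζ P a = D.t a) ∧ (D.up a = true → D.ζ P a = D.t a - 3 * D.k P a) := by
  unfold ζ; constructor <;> intro h <;> simp [h]

/-- **The spoke rows of distinct exits on a common side are six chunks apart** (with the height
`2ε` of the spokes): in every relative position — from the row gaps of good tip data, or, in the two
glued positions, because the spokes point away from each other. [cite: Nolin2008, §4.2 Def. 6–8 and §4.4 (arXiv 0711.4948), free spaces of consecutive arms] -/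
theorem Good.gap (hV : P.ValidA) (hD : D.Good P) {a b : Fin 4} (hab : a ≠ b) (hi : D.i a = D.i b) (hlt : D.t a < D.t b) :
    D.ξ P a + 2 * P.ε + 6 * P.sA < D.ξ P b := by
  obtain ⟨ka1, -, hsA, hw1, hε1, hk₀, fa1, fa2, hξa, za1, za2, -⟩ := hD.facts hV a
  obtain ⟨kb1, -, -, -, -, -, fb1, fb2, hξb, zb1, zb2, -⟩ := hD.facts hV b
  have hζa := D.ζ_eq (P := P) a
  have hζb := D.ζ_eq (P := P) b
  by_cases hcol : col a = col b
  · -- same colour: both fences from below, `17k` apart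
    obtain ⟨hua, hgap⟩ := hD.hsame a b hab hcol hi
    obtain ⟨hub, -⟩ := hD.hsame b a (Ne.symm hab) hcol.symm hi.symm
    have g := hgap hlt
    have e1 := hζa.1 hua; have e2 := hζb.1 hub
    omega
  · -- other colour: by kinds
    have g1 := hD.hdiff a b hcol hi
    have g2 := hD.hdiff b a (Ne.symm hcol) hi.symm
    cases hua : D.up a <;> cases hub : D.up b <;>
      simp only [hua, hub, true_and, false_and, or_false, false_or, Bool.false_eq_true, Bool.true_eq_false] at g1 g2 <;>
      [have e1 := hζa.1 hua; have e1 := hζa.1 hua; have e1 := hζa.2 hua; have e1 := hζa.2 hua] <;>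
      [have e2 := hζb.1 hub; have e2 := hζb.2 hub; have e2 := hζb.1 hub; have e2 := hζb.2 hub] <;>
      omega

/-- **On a common side the spoke rows are in the order of the tips.** [folklore] -/
theorem Good.t_lt_iff (hV : P.ValidA) (hD : D.Good P) {a b : Fin 4} (hab : a ≠ b) (hi : D.i a = D.i b) :
    D.t a < D.t b ↔ D.ξ P a < D.ξ P b := by
  have hε : (0 : ℤ) ≤ P.ε := by positivity
  have hs : (0 : ℤ) ≤ P.sA := by positivity
  constructor
  · intro h; linarith [hD.gap hV hab hi h]
  · intro h
    rcases lt_trichotomy (D.t a) (D.t b) with h' | h' | h'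
    · exact h'
    · exact absurd h' (hD.htne a b hab hi)
    · linarith [hD.gap hV (Ne.symm hab) hi.symm h']

/-- **The lane object of an exit is in range** on every ring of radius `r ≥ 2M` (chunk `sA`). [folklore] -/
theorem Good.obj_ok (hV : P.ValidA) (hD : D.Good P) {r : ℕ} (hr : 2 * P.M ≤ r) (a : Fin 4) :
    (D.obj P a).OK P.sA r P.M := by
  obtain ⟨ka1, kμ, hsA, hw1, hε1, hk₀, fa1, fa2, hξa, za1, za2, g1, g2, hR₀, hR₀M⟩ := hD.facts hV a
  have hζa := D.ζ_eq (P := P) a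
  refine ⟨hD.hi a, ?_, ?_, ?_, hr⟩
  · show D.ξ P a ≤ D.ξ P a + 2 * P.ε
    have : (0 : ℤ) ≤ P.ε := by positivity
    linarith
  · show -(2 * (P.M : ℤ)) + 2 * P.sA ≤ D.ξ P a
    cases hua : D.up a
    · have e1 := hζa.1 hua; omega
    · have e1 := hζa.2 hua; omega
  · show D.ξ P a + 2 * P.ε + 4 * P.sA < 0
    cases hua : D.up a
    · have e1 := hζa.1 hua; omega
    · have e1 := hζa.2 hua; omega

/-- **The lane objects of distinct exits are separated** (three chunks on a common side). [folklore] -/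
theorem Good.obj_sep (hV : P.ValidA) (hD : D.Good P) {a b : Fin 4} (hab : a ≠ b) : RingObj.Sep P.sA (D.obj P a) (D.obj P b) := by
  intro hi
  change D.i a = D.i b at hi
  show D.ξ P a + 2 * P.ε + 3 * P.sA ≤ D.ξ P b ∨ D.ξ P b + 2 * P.ε + 3 * P.sA ≤ D.ξ P a
  have hs : (0 : ℤ) ≤ P.sA := by positivity
  rcases lt_trichotomy (D.t a) (D.t b) with h | h | h
  · left; linarith [hD.gap hV hab hi h]
  · exact absurd h (hD.htne a b hab hi)
  · right; linarith [hD.gap hV (Ne.symm hab) hi.symm h]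

/-- **Spoke keys lie well inside their blocks**: `2M i + 2 sA ≤ κ < 2M(i+1) - 4 sA - 2ε`. [folklore] -/
theorem Good.κ_mem (hV : P.ValidA) (hD : D.Good P) (a : Fin 4) :
    2 * (P.M : ℤ) * (D.i a) + 2 * P.sA ≤ D.κ P a ∧ D.κ P a + 2 * P.ε + 4 * P.sA < 2 * (P.M : ℤ) * (D.i a + 1) := by
  obtain ⟨-, -, hlo, hhi, -⟩ := hD.obj_ok hV le_rfl a
  change -(2 * (P.M : ℤ)) + 2 * P.sA ≤ D.ξ P a at hlo
  change D.ξ P a + 2 * P.ε + 4 * P.sA < 0 at hhi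
  unfold κ rotKey
  constructor <;> linarith

/-- Spoke keys lie in `[0, 12M)`. [folklore] -/
theorem Good.κ_range (hV : P.ValidA) (hD : D.Good P) (a : Fin 4) : 0 ≤ D.κ P a ∧ D.κ P a < 12 * P.M := by
  obtain ⟨h1, h2⟩ := hD.κ_mem hV a
  have hi : (D.i a : ℤ) ≤ 5 := by have := hD.hi a; omega
  have hM : (0 : ℤ) ≤ P.M := by positivity
  have hi0 : (0 : ℤ) ≤ D.i a := by positivity
  have hs : (0 : ℤ) ≤ P.sA := by positivity
  have hε : (0 : ℤ) ≤ P.ε := by positivity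
  constructor <;> nlinarith

/-- **Spoke keys of distinct exits differ**, by six chunks and the spoke height: on a common side by
`Good.gap`, on different sides by the block structure. [folklore] -/
theorem Good.κ_far (hV : P.ValidA) (hD : D.Good P) {a b : Fin 4} (hab : a ≠ b) :
    D.κ P a + 2 * P.ε + 6 * P.sA ≤ D.κ P b ∨ D.κ P b + 2 * P.ε + 6 * P.sA ≤ D.κ P a := by
  by_cases hi : D.i a = D.i b
  · rcases lt_trichotomy (D.t a) (D.t b) with h | h | h
    · left; have g := hD.gap hV hab hi h; unfold κ rotKey; rw [hi]; linarith
    · exact absurd h (hD.htne a b hab hi)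
    · right; have g := hD.gap hV (Ne.symm hab) hi.symm h; unfold κ rotKey; rw [hi]; linarith
  · obtain ⟨a1, a2⟩ := hD.κ_mem hV a
    obtain ⟨b1, b2⟩ := hD.κ_mem hV b
    have hM : (0 : ℤ) ≤ P.M := by positivity
    have hs : (0 : ℤ) ≤ P.sA := by positivity
    rcases Nat.lt_or_gt_of_ne hi with h | h
    · left
      have : (D.i a : ℤ) + 1 ≤ D.i b := by exact_mod_cast h
      nlinarith
    · right
      have : (D.i b : ℤ) + 1 ≤ D.i a := by exact_mod_cast h
      nlinarith

/-- **Tip keys and spoke keys compare alike** (pairwise). [folklore] -/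
theorem Good.κt_lt_iff (hV : P.ValidA) (hD : D.Good P) {a b : Fin 4} (hab : a ≠ b) :
    D.κt P a < D.κt P b ↔ D.κ P a < D.κ P b := by
  obtain ⟨-, -, -, -, -, hk₀, -, -, -, -, -, ga1, ga2, hR₀, -⟩ := hD.facts hV a
  obtain ⟨-, -, -, -, -, -, -, -, -, -, -, gb1, gb2, -, -⟩ := hD.facts hV b
  obtain ⟨ka1, ka2⟩ := hD.κ_mem hV a
  obtain ⟨kb1, kb2⟩ := hD.κ_mem hV b
  have hμ : (P.k₀ : ℤ) ≤ P.μ := by unfold OParams.μ; exact_mod_cast le_trapScale P.k₀ P.K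
  have hs : (0 : ℤ) ≤ P.sA := by positivity
  have hε : (0 : ℤ) ≤ P.ε := by positivity
  have hM : (0 : ℤ) ≤ P.M := by positivity
  by_cases hi : D.i a = D.i b
  · have h1 := hD.t_lt_iff hV hab hi
    unfold κt κ rotKey
    rw [← hi]
    constructor
    · intro h; have := h1.1 (by linarith); linarith
    · intro h; have := h1.2 (by linarith); linarith
  · -- different blocks: both orders are the order of the sides
    have ta : 2 * (P.M : ℤ) * (D.i a) < D.κt P a ∧ D.κt P a < 2 * (P.M : ℤ) * (D.i a + 1) := by
      unfold κt rotKey; constructor <;> linarith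
    have tb : 2 * (P.M : ℤ) * (D.i b) < D.κt P b ∧ D.κt P b < 2 * (P.M : ℤ) * (D.i b + 1) := by
      unfold κt rotKey; constructor <;> linarith
    rcases Nat.lt_or_gt_of_ne hi with h | h
    · have : (D.i a : ℤ) + 1 ≤ D.i b := by exact_mod_cast h
      constructor <;> intro <;> nlinarith
    · have : (D.i b : ℤ) + 1 ≤ D.i a := by exact_mod_cast h
      constructor <;> intro h' <;> nlinarith

end AdjTipData

end Literature.Probability.Percolation
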